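import Literature.NumberTheory.EllipticCurves.CPMuDescentGlobal
import Literature.NumberTheory.EllipticCurves.MordellCurveCubicDescentLocal
import Literature.NumberTheory.EllipticCurves.ThreeTorsionDescentValuation
import Literature.NumberTheory.NumberFields.EisensteinFieldSelmerNormCube
import Literature.NumberTheory.NumberFields.EisensteinFieldLocal
import HarnessLib

/-!
# The carrier `y² − 21xy + 6137y = x³` over `ℚ(ζ₃)`: the `φ`-Selmer box `⟨[ζ₃]⟩` is filled by a rational
# point, so `[C_u] = 0` for every `u` of cube norm with `[C_u] ∈ Ш(E/ℚ(ζ₃))`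
# (Cohen–Pazuki 2009, Prop. 2.2 / Thm. 2.1 with §4–6, the side `D̂ = −3`)

Topic `NumberTheory/EllipticCurves`. The `ℤ/3`-kernel side of the `3`-isogeny descent of the
cross-prime carrier `E = threeTorsionModel (−21/2) (6137/2)` of route ShaPrimaryTransfer. Over
`K3 = ℚ(ζ₃)` the rational kernel `⟨(0, 6137/2)⟩` IS a `μ₃`-kernel datum: with `θ₀ ∈ K3`,
`θ₀² = −3`, the base change of `E` is Cohen–Pazuki's

  `cpCurve a₃ b₃`, `a₃ = (7/2)θ₀`, `b₃ = −(6137/6)θ₀` (`cpCurve_eq_threeTorsionModel`),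

whose scaled isogenous curve (`t = −1`) is `Ê₃ = threeTorsionModel (−(21/2)θ₀) (9720 θ₀)`
(`= V = cpCurve (−21/2) 9720` over `K3`), descent map `α̂(X, Y) = Y − θ₀(−(21/2)X + 9720)`.

* `three_dvd_log_valuation_of_torsorClass_mem_sha` — `[C_u] ∈ Ш(E/K3)` ⇒ `3 ∣ ord_w(u)` at every
  `w ∌ 30` (local necessity `CPMuDescentLocal` at `K3_w`; `2ŝ = 19440 θ₀ = 2⁴3⁵5·θ₀` is a `w`-unit).
* `descentClass_P₁'` — the `K3`-point `P₁' = (513, −17739/2)` of `Ê₃` (image of the rational point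
  `(366, 17739/2)` of the tree's `threeIsogenyCodomain`, cf. `Curve6137ThreeDescentCobox`) has
  `α̂(P₁') = −17739/2 − (8667/2)θ₀ = ζ²(−24 − 21ζ)³` or `ζ(−3 + 21ζ)³` (as `θ₀ = ±(2ζ + 1)`): its class
  generates `⟨[ζ]⟩`.
* **`torsorClass_eq_zero_of_mem_sha_of_norm_cube`** — if `[C_u] ∈ Ш(E/K3)` and `N(u) ∈ ℚ*³`
  (Cohen–Pazuki's `G₃`) then `[u] ∈ ⟨[ζ]⟩` (`EisensteinFieldSelmerNormCube`) and hence `[C_u] = 0`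
  (`CPMuDescentGlobal`): the `φ`-Selmer group of `E/ℚ`, read inside `K3*/K3*³`, is filled by `Ê(ℚ)`.

## References

* [CohenPazuki2009] H. Cohen, F. Pazuki, Acta Arith. 140 (2009), Def. 1.3, Prop. 1.4, Thm. 2.1,
  Prop. 2.2.
* Tree: `CPMuDescentCurve/Local/Global`, `EisensteinFieldSelmerNormCube`, `EisensteinFieldLocal`,
  `Curve6137ThreeDescentCobox` (the point `(366, 17739/2)`).
-/

noncomputable section

open scoped Classical WithZero

open WeierstrassCurve IsDedekindDomain IsDedekindDomain.HeightOneSpectrum NumberField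
open WithZero (log exp)

namespace Literature.NumberTheory.EllipticCurves

namespace Carrier6137

open MordellDescent ThreeTorsionDescent CPMuDescent MuThreeKernel
open Literature.NumberTheory.NumberFields Literature.NumberTheory.NumberFields.K3

/-! ## The parameters over `K3` -/

section Params

variable {θ₀ : K3} (hθ : θ₀ ^ 2 = -3)
include hθ

/-- `θ₀ ≠ 0`. [cite: CohenPazuki2009, §1.2] -/
theorem theta0_ne_zero : θ₀ ≠ 0 := by
  intro h; rw [h] at hθ; norm_num at hθ

/-- `b₃ = −(6137/6)θ₀ ≠ 0`. [cite: CohenPazuki2009, §1.2] -/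
theorem hb₃ : -(6137 / 6 : K3) * θ₀ ≠ 0 := mul_ne_zero (by norm_num) (theta0_ne_zero hθ)

/-- `4a₃³ + 9b₃ = −9720 θ₀ ≠ 0`. [cite: CohenPazuki2009, §1.2] -/
theorem hd₃ : 4 * ((7 / 2 : K3) * θ₀) ^ 3 + 9 * (-(6137 / 6 : K3) * θ₀) ≠ 0 := by
  have e : 4 * ((7 / 2 : K3) * θ₀) ^ 3 + 9 * (-(6137 / 6 : K3) * θ₀) = -9720 * θ₀ := by
    have h3 : θ₀ ^ 3 = -3 * θ₀ := by rw [pow_succ, hθ]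
    linear_combination (343 / 2 : K3) * h3
  rw [e]; exact mul_ne_zero (by norm_num) (theta0_ne_zero hθ)

omit hθ in
/-- `t = −1`: `(−1)·(−(21/2)θ₀) = 3a₃`. [cite: CohenPazuki2009, Definition 1.3] -/
theorem hm₃ : (-1 : K3) * (-(21 / 2) * θ₀) = 3 * ((7 / 2 : K3) * θ₀) := by ring

/-- `t = −1`: `(−1)³·(9720 θ₀) = 4a₃³ + 9b₃`. [cite: CohenPazuki2009, Definition 1.3] -/
theorem hs₃ : (-1 : K3) ^ 3 * (9720 * θ₀) = 4 * ((7 / 2 : K3) * θ₀) ^ 3 + 9 * (-(6137 / 6 : K3) * θ₀) := by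
  have h3 : θ₀ ^ 3 = -3 * θ₀ := by rw [pow_succ, hθ]
  linear_combination (-343 / 2 : K3) * h3

/-- **`cpCurve a₃ b₃` is the base change of the carrier**: `= threeTorsionModel (−21/2) (6137/2)` over
`K3`. [cite: CohenPazuki2009, §1.2] -/
theorem cpCurve_eq_threeTorsionModel :
    cpCurve ((7 / 2 : K3) * θ₀) (-(6137 / 6 : K3) * θ₀) = threeTorsionModel (-21 / 2 : K3) (6137 / 2) := by
  refine WeierstrassCurve.ext rfl ?_ rfl ?_ ?_
  · simp only [cpCurve_a₂, threeTorsionModel_a₂]; linear_combination (-147 / 4 : K3) * hθ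
  · simp only [cpCurve_a₄, threeTorsionModel_a₄]; linear_combination (42959 / 2 : K3) * hθ
  · simp only [cpCurve_a₆, threeTorsionModel_a₆]; linear_combination (-37662769 / 12 : K3) * hθ

/-- `θ₀ = ±θ` for the tree's `K3.theta = 2ζ + 1`. [cite: CohenPazuki2009, §1.2] -/
theorem theta0_eq_or : θ₀ = K3.theta ∨ θ₀ = -K3.theta := by
  have h : θ₀ ^ 2 = K3.theta ^ 2 := by rw [hθ, K3.theta_sq]
  exact sq_eq_sq_iff_eq_or_eq_neg.mp h

end Params

/-! ## Valuations at the places `w ∌ 30` of `K3` -/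

/-- `w(3) = 1` at `w ∌ 30`. [cite: CohenPazuki2009, Theorem 2.1] -/
theorem valuation_three_eq_one {w : HeightOneSpectrum (𝓞 K3)} (hw : (30 : 𝓞 K3) ∉ w.asIdeal) :
    w.valuation K3 3 = 1 := by
  have := valuation_coe_eq_one_of_dvd w hw (y := ((3 : ℕ) : 𝓞 K3)) ⟨10, by norm_num⟩
  rwa [coe_natCast_ringOfIntegers, Nat.cast_ofNat] at this

/-- `w(θ₀) = 1` at `w ∌ 30` (`θ₀² = −3` is a `w`-unit). [cite: CohenPazuki2009, Theorem 2.1] -/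
theorem valuation_theta0_eq_one {θ₀ : K3} (hθ : θ₀ ^ 2 = -3) {w : HeightOneSpectrum (𝓞 K3)}
    (hw : (30 : 𝓞 K3) ∉ w.asIdeal) : w.valuation K3 θ₀ = 1 := by
  have h : (w.valuation K3 θ₀) ^ 2 = 1 := by
    rw [← Valuation.map_pow, hθ, Valuation.map_neg, valuation_three_eq_one hw]
  exact (pow_eq_one_iff.mp h).resolve_right two_ne_zero

/-- `w(19440 θ₀) = 1` at `w ∌ 30` (`19440 = 2⁴·3⁵·5`). [cite: CohenPazuki2009, Theorem 2.1] -/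
theorem valuation_two_s₂ {θ₀ : K3} (hθ : θ₀ ^ 2 = -3) {w : HeightOneSpectrum (𝓞 K3)}
    (hw : (30 : 𝓞 K3) ∉ w.asIdeal) : w.valuation K3 (2 * (9720 * θ₀)) = 1 := by
  obtain ⟨h2, h5⟩ := valuation_two_five_of_thirty hw
  have h3 := valuation_three_eq_one hw
  rw [show (2 : K3) * (9720 * θ₀) = 2 ^ 4 * 3 ^ 5 * 5 * θ₀ by ring, Valuation.map_mul,
    Valuation.map_mul, Valuation.map_mul, Valuation.map_pow, Valuation.map_pow, h2, h3, h5,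
    valuation_theta0_eq_one hθ hw]
  simp

/-- `w(−21 θ₀) ≤ 1` at `w ∌ 30`. [cite: CohenPazuki2009, Theorem 2.1] -/
theorem valuation_two_m₂ {θ₀ : K3} (hθ : θ₀ ^ 2 = -3) {w : HeightOneSpectrum (𝓞 K3)}
    (hw : (30 : 𝓞 K3) ∉ w.asIdeal) : w.valuation K3 (2 * (-(21 / 2) * θ₀)) ≤ 1 := by
  have h21 : w.valuation K3 (21 : K3) ≤ 1 := by
    have := IsDedekindDomain.HeightOneSpectrum.valuation_le_one (K := K3) w (21 : 𝓞 K3)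
    exact_mod_cast this
  rw [show (2 : K3) * (-(21 / 2) * θ₀) = -(21 * θ₀) by ring, Valuation.map_neg, Valuation.map_mul,
    valuation_theta0_eq_one hθ hw, mul_one]
  exact h21

/-! ## Local necessity at `w ∌ 30` -/

/-- Valuation bookkeeping (as in `Curve6137MuDescentSelmer.three_dvd_log_of_descent_pow_eq`, over any
base field). [cite: CohenPazuki2009, Theorem 2.1 (2)] -/
theorem three_dvd_log_of_descent_pow_eq' {k F : Type*} [Field k] [Field F] (V : Valuation F ℤᵐ⁰)
    (φ : k →+* F) {m s u : k} (hs : V (φ (2 * s)) = 1) (hm : V (φ (2 * m)) ≤ 1) (hu : u ≠ 0)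
    {P : (threeTorsionModel (φ m) (φ s)).toAffine.Point} {w : F} {e : ℕ} (hw : w ≠ 0)
    (hP : descent (threeTorsionModel (φ m) (φ s)) (φ m) (φ s) P ^ e = φ u * w ^ 3) :
    (3 : ℤ) ∣ WithZero.log (V (φ u)) := by
  have hvs : V (2 * φ s) = 1 := by rw [← map_ofNat φ 2, ← map_mul, hs]
  have hvm : V (2 * φ m) ≤ 1 := by rw [← map_ofNat φ 2, ← map_mul]; exact hm
  have hδ := V.three_dvd_log_threeTorsionDescent rfl hvs hvm P
  have huF : φ u ≠ 0 := (map_ne_zero φ).mpr hu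
  have key := congrArg (fun z => WithZero.log (V z)) hP
  rw [V.log_map_pow, V.log_map_mul huF (pow_ne_zero 3 hw), V.log_map_pow] at key
  obtain ⟨c, hc⟩ := hδ
  rw [hc] at key
  exact ⟨e * c - WithZero.log (V w), by linear_combination -key⟩

/-- **`[C_u] ∈ Ш(E/K3) ⟹ 3 ∣ ord_w(u)` at every place `w ∌ 30` of `K3`.**
[cite: CohenPazuki2009, Theorem 2.1 (2)] -/
theorem three_dvd_log_valuation_of_torsorClass_mem_sha {θ₀ : K3} (hθ : θ₀ ^ 2 = -3) {u : K3} (hu : u ≠ 0)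
    (hsha : (kernelDatum (hb₃ hθ) (hd₃ hθ)).torsorClass hu ∈
      (cpCurve ((7 / 2 : K3) * θ₀) (-(6137 / 6 : K3) * θ₀)).sha)
    (w : HeightOneSpectrum (𝓞 K3)) (hw : (30 : 𝓞 K3) ∉ w.asIdeal) :
    (3 : ℤ) ∣ log (w.valuation K3 u) := by
  obtain ⟨P, w', e, hw', hP⟩ :=
    exists_descent_pow_eq_adicCompletion_of_torsorClass_mem_sha (hb₃ hθ) (hd₃ hθ) (t := -1)
      (by norm_num) hm₃ (hs₃ hθ) hu hsha w
  have hval : ∀ x : K3, Valued.v (algebraMap K3 (w.adicCompletion K3) x) = w.valuation K3 x :=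
    fun x => valuedAdicCompletion_eq_valuation' w x
  have key := three_dvd_log_of_descent_pow_eq' Valued.v (algebraMap K3 (w.adicCompletion K3))
    (by rw [hval]; exact valuation_two_s₂ hθ hw) (by rw [hval]; exact valuation_two_m₂ hθ hw) hu hw' hP
  rwa [hval] at key

/-! ## The point `P₁' = (513, −17739/2)` of `Ê₃` and its descent class -/

/-- `P₁' = (513, −17739/2)` lies on `Ê₃ = threeTorsionModel (−(21/2)θ₀) (9720 θ₀)`.
[cite: CohenPazuki2009, Proposition 2.2] -/
theorem nonsingular_P₁' {θ₀ : K3} (hθ : θ₀ ^ 2 = -3) :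
    (threeTorsionModel (-(21 / 2) * θ₀) (9720 * θ₀)).toAffine.Nonsingular 513 (-17739 / 2) := by
  have hΔ : (threeTorsionModel (-(21 / 2) * θ₀) (9720 * θ₀)).Δ ≠ 0 :=
    Δ_scaled_ne (hb₃ hθ) (hd₃ hθ) hm₃ (hs₃ hθ)
  refine (Affine.equation_iff_nonsingular_of_Δ_ne_zero hΔ).mp ?_
  rw [ThreeTorsionDescent.equation_iff_of_eq rfl]
  linear_combination (-75116889 / 4 : K3) * hθ

/-- **`[α̂(P₁')] = [ζ]` or `[ζ²]`**: `α̂(P₁') = −17739/2 − (8667/2)θ₀`, which is `ζ²(−24 − 21ζ)³` for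
`θ₀ = θ` and `ζ(−3 + 21ζ)³` for `θ₀ = −θ` (cf. `α̂ = 4536 − 8667ζ = ζ(3 − 21ζ)³` of the rational point
`(366, 17739/2)`, `Curve6137ThreeDescentCobox`). [cite: CohenPazuki2009, Proposition 2.2] -/
theorem descentClass_P₁' {θ₀ : K3} (hθ : θ₀ ^ 2 = -3) :
    descentClass (threeTorsionModel (-(21 / 2) * θ₀) (9720 * θ₀)) (-(21 / 2) * θ₀) (9720 * θ₀)
        (.some 513 (-17739 / 2) (nonsingular_P₁' hθ)) = cubeClass (zeta ^ 2) ∨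
      descentClass (threeTorsionModel (-(21 / 2) * θ₀) (9720 * θ₀)) (-(21 / 2) * θ₀) (9720 * θ₀)
        (.some 513 (-17739 / 2) (nonsingular_P₁' hθ)) = cubeClass zeta := by
  have hz0 : (zeta : K3) ≠ 0 := isPrimitiveRoot_zeta.ne_zero (by norm_num)
  have hval : (-17739 / 2 : K3) - -(21 / 2) * θ₀ * 513 - 9720 * θ₀ = -17739 / 2 - 8667 / 2 * θ₀ := by ring
  have hne : (-17739 / 2 : K3) - -(21 / 2) * θ₀ * 513 - 9720 * θ₀ ≠ 0 := by
    rw [hval]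
    intro h0
    have h1 : (8667 / 2 : K3) * θ₀ = -17739 / 2 := by linear_combination -h0
    have h2 : ((8667 / 2 : K3) * θ₀) ^ 2 = (-17739 / 2) ^ 2 := by rw [h1]
    rw [mul_pow, hθ] at h2
    norm_num at h2
  rw [descentClass, descent_some_of_ne _ _ _ hne, hval]
  rw [hval] at hne
  rcases theta0_eq_or hθ with h | h <;> subst h <;> rw [K3.theta] at hne ⊢
  · left
    have e : (-17739 / 2 : K3) - 8667 / 2 * (2 * zeta + 1) = zeta ^ 2 * (-24 - 21 * zeta) ^ 3 := by
      linear_combination (-(13203 : K3) + 4536 * zeta + 22491 * zeta ^ 2 + 9261 * zeta ^ 3) * zeta_sq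
    have hw0 : (-24 - 21 * zeta : K3) ≠ 0 := fun h0 => hne (by rw [e, h0]; ring)
    rw [e, cubeClass_mul_pow_three (pow_ne_zero 2 hz0) hw0]
  · right
    have e : (-17739 / 2 : K3) - 8667 / 2 * -(2 * zeta + 1) = zeta * (-3 + 21 * zeta) ^ 3 := by
      linear_combination (-(4536 : K3) + 13230 * zeta - 9261 * zeta ^ 2) * zeta_sq
    have hw0 : (-3 + 21 * zeta : K3) ≠ 0 := fun h0 => hne (by rw [e, h0]; ring)
    rw [e, cubeClass_mul_pow_three hz0 hw0]

/-- Hence **`[ζ^i] ∈ ⟨[α̂(P)] : P ∈ Ê₃(K3)⟩`** for all `i`. [cite: CohenPazuki2009, Proposition 2.2] -/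
theorem cubeClass_zeta_pow_mem_closure {θ₀ : K3} (hθ : θ₀ ^ 2 = -3) (i : ℕ) :
    cubeClass (zeta ^ i) ∈ Subgroup.closure (Set.range fun P :
      (threeTorsionModel (-(21 / 2) * θ₀) (9720 * θ₀)).toAffine.Point =>
        descentClass (threeTorsionModel (-(21 / 2) * θ₀) (9720 * θ₀)) (-(21 / 2) * θ₀) (9720 * θ₀) P) := by
  set S := Subgroup.closure (Set.range fun P :
      (threeTorsionModel (-(21 / 2) * θ₀) (9720 * θ₀)).toAffine.Point =>
        descentClass (threeTorsionModel (-(21 / 2) * θ₀) (9720 * θ₀)) (-(21 / 2) * θ₀) (9720 * θ₀) P) with hS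
  have hz0 : (zeta : K3) ≠ 0 := isPrimitiveRoot_zeta.ne_zero (by norm_num)
  have hpow : ∀ n : ℕ, cubeClass (zeta ^ n) = cubeClass zeta ^ n := by
    intro n; induction n with
    | zero => rw [pow_zero, pow_zero, cubeClass_one]
    | succ n ih => rw [pow_succ, pow_succ, cubeClass_mul (pow_ne_zero _ hz0) hz0, ih]
  have hζ : cubeClass zeta ∈ S := by
    rcases descentClass_P₁' hθ with h | h
    · -- `[ζ²] ∈ S`, and `[ζ] = [ζ²]² · [ζ³]⁻¹ = [ζ²]²`
      have h2 : cubeClass (zeta ^ 2) ∈ S := by rw [← h]; exact Subgroup.subset_closure ⟨_, rfl⟩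
      have e : cubeClass zeta = cubeClass (zeta ^ 2) * cubeClass (zeta ^ 2) := by
        rw [← cubeClass_mul (pow_ne_zero _ hz0) (pow_ne_zero _ hz0), show zeta ^ 2 * zeta ^ 2 = zeta * zeta ^ 3 by ring,
          cubeClass_mul_pow_three hz0 hz0]
      rw [e]; exact S.mul_mem h2 h2
    · rw [← h]; exact Subgroup.subset_closure ⟨_, rfl⟩
  rw [hpow]; exact S.pow_mem hζ i

/-! ## Conclusion: cube-norm Selmer classes are trivial -/

/-- **`[C_u] ∈ Ш(E/K3)` with `N(u) ∈ ℚ*³` implies `[C_u] = 0`.** By local necessity `3 ∣ ord_w(u)` for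
all `w ∌ 30`; with the norm condition, `[u] = [ζ^i]` (`K(S,3) ∩ G₃ = ⟨[ζ]⟩`,
`EisensteinFieldSelmerNormCube`); and `[ζ^i]` is a product of descent classes of `K3`-points of
`Ê₃`, which have trivial torsor class (`CPMuDescentGlobal`). This is the `φ`-side of the `3`-descent
of the carrier: its `φ`-Selmer group (inside `G₃ ⊂ K3*/K3*³`) is filled by `Ê(ℚ)`.
[cite: CohenPazuki2009, Theorem 2.1 and Proposition 2.2] -/
theorem torsorClass_eq_zero_of_mem_sha_of_norm_cube {θ₀ : K3} (hθ : θ₀ ^ 2 = -3) {u : K3} (hu : u ≠ 0)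
    (hsha : (kernelDatum (hb₃ hθ) (hd₃ hθ)).torsorClass hu ∈
      (cpCurve ((7 / 2 : K3) * θ₀) (-(6137 / 6 : K3) * θ₀)).sha)
    (hnorm : ∃ r : ℚ, QuadraticAlgebra.norm u = r ^ 3) :
    (kernelDatum (hb₃ hθ) (hd₃ hθ)).torsorClass hu = 0 := by
  obtain ⟨i, -, hi⟩ := exists_cubeClass_eq_zeta_pow_of_norm_cube hu
    (fun w hw => three_dvd_log_valuation_of_torsorClass_mem_sha hθ hu hsha w hw) hnorm
  rw [(kernelDatum (hb₃ hθ) (hd₃ hθ)).torsorClass_eq_zero_iff_cubeClass_mem_ker hu, hi, MonoidHom.mem_ker]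
  exact torsorClassQuotHom_eq_one_of_mem_closure (hb₃ hθ) (hd₃ hθ) (t := -1) (by norm_num) hm₃
    (hs₃ hθ) (cubeClass_zeta_pow_mem_closure hθ i)

end Carrier6137

end Literature.NumberTheory.EllipticCurves

end
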